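import Mathlib
import HarnessLib
import Summits.Ventures.LatticeQCDFlow.Scaling.MetricTunnellingSectors
import Summits.Ventures.LatticeQCDFlow.Scaling.MetricTunnellingUN

/-!
# LatticeQCDFlow / Scaling — the intrinsic small-step tunnelling law on `U(N)^E` (v3.1, explicit constants)

HONEST FRAMING: exact (Metropolis-corrected) sampling algorithms for lattice gauge theory; figures
of merit are autocorrelation/cost numbers at stated couplings and volumes; no continuum-physics
claim.

THEORY-2.md §3.3 (C2c-T) / conjecture C7(a), charge-free form, `U(N)` instance: the sector laws of
`MetricTunnellingSectors.lean` (sector of `x` := `connectedComponentIn Dᶜ x`, any defect set `D`)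
combined with the `(ρ, 2ρ)`-local paths on `U(N)` of `MetricTunnellingUN.lean` (Cayley chart,
`ρ ≤ 1/8`, constants independent of `N` and of the volume):

* `UN.exists_localPaths_config` — `(ρ, 2ρ)`-local paths on `U(N)^E` (sup metric, any finite `E`);
* **`UN.compProd_sector_ne_le`** — for `0 ≤ ρ ≤ 1/8`, every set `D ⊆ U(N)^E`, every s-finite `m`
  and `m`-invariant Markov kernel with a.s. `ρ`-small moves:
  `(m ⊗ₘ κ){sector ≠ sector'} ≤ 2·m(cthickening (2ρ) D)`; `…_add` (exceptional-set form);
  **`UN.measure_sector_ne_le_nsteps`** (`n`-step persistence).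
No sorry, no new axioms, no `def`.
-/

noncomputable section

open scoped Matrix.Norms.Frobenius ENNReal ProbabilityTheory
open MeasureTheory ProbabilityTheory Metric Set
open Literature.MathematicalPhysics.QuantumFieldTheory.UnitaryCayley (𝔾)

namespace Summit.Ventures.LatticeQCDFlow.Theory2.Lattice.UN

open Summit.Ventures.LatticeQCDFlow.Theory2.Tunnelling

variable {N : ℕ}

/-- `(ρ, 2ρ)`-local paths on `U(N)^E` (`0 ≤ ρ ≤ 1/8`; sup metric over any finite index type).
[folklore] -/
theorem exists_localPaths_config {E : Type*} [Fintype E] {ρ : ℝ} (hρ0 : 0 ≤ ρ) (hρ : ρ ≤ 1 / 8)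
    (U V : E → 𝔾 N) (hUV : dist U V ≤ ρ) :
    ∃ γ : ℝ → (E → 𝔾 N), ContinuousOn γ (Icc (0 : ℝ) 1) ∧ γ 0 = U ∧ γ 1 = V ∧
      ∀ t ∈ Icc (0 : ℝ) 1, dist (γ t) U ≤ 2 * ρ :=
  exists_localPath_pi_radii (by positivity) (fun a b hab => exists_localPaths hρ0 hρ a b hab) U V hUV

/-- **`U(N)` intrinsic small-step tunnelling law** (explicit, `N`- and volume-independent constants):
for `0 ≤ ρ ≤ 1/8`, EVERY set `D ⊆ U(N)^E`, every s-finite `m` and every `m`-invariant Markov kernel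
with a.s. `ρ`-small moves, `(m ⊗ₘ κ){sector ≠ sector'} ≤ 2·m(cthickening (2ρ) D)`. [folklore] -/
theorem compProd_sector_ne_le {E : Type*} [Fintype E] {ρ : ℝ} (hρ0 : 0 ≤ ρ) (hρ : ρ ≤ 1 / 8)
    (D : Set (E → 𝔾 N)) (m : Measure (E → 𝔾 N)) [SFinite m]
    (κ : Kernel (E → 𝔾 N) (E → 𝔾 N)) [IsMarkovKernel κ] (hinv : κ.Invariant m)
    (hstep : ∀ᵐ q ∂(m ⊗ₘ κ), dist q.1 q.2 ≤ ρ) :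
    (m ⊗ₘ κ) {q | connectedComponentIn Dᶜ q.1 ≠ connectedComponentIn Dᶜ q.2} ≤
      2 * m (cthickening (2 * ρ) D) :=
  compProd_sector_ne_le_two_mul_cthickening
    (fun a b hab => exists_localPaths_config hρ0 hρ a b hab) m κ hinv hstep

/-- **`U(N)` intrinsic law with an exceptional set** (moves longer than `ρ` allowed, their
`m ⊗ₘ κ`-mass added). [folklore] -/
theorem compProd_sector_ne_le_add {E : Type*} [Fintype E] {ρ : ℝ} (hρ0 : 0 ≤ ρ) (hρ : ρ ≤ 1 / 8)
    (D : Set (E → 𝔾 N)) (m : Measure (E → 𝔾 N)) [SFinite m]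
    (κ : Kernel (E → 𝔾 N) (E → 𝔾 N)) [IsMarkovKernel κ] (hinv : κ.Invariant m) :
    (m ⊗ₘ κ) {q | connectedComponentIn Dᶜ q.1 ≠ connectedComponentIn Dᶜ q.2} ≤
      2 * m (cthickening (2 * ρ) D) + (m ⊗ₘ κ) {q | ¬ dist q.1 q.2 ≤ ρ} :=
  compProd_sector_ne_le_two_mul_cthickening_add
    (fun a b hab => exists_localPaths_config hρ0 hρ a b hab) m κ hinv

/-- **`U(N)` `n`-step sector persistence**: for a process on `U(N)^E` with one-time marginals `m`
and a.s. steps `≤ ρ ≤ 1/8`, `P{sector(Z n) ≠ sector(Z 0)} ≤ n·2·m(cthickening (2ρ) D)`. [folklore] -/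
theorem measure_sector_ne_le_nsteps {E : Type*} [Fintype E] {ρ : ℝ} (hρ0 : 0 ≤ ρ) (hρ : ρ ≤ 1 / 8)
    (D : Set (E → 𝔾 N)) {Ω : Type*} [MeasurableSpace Ω] (P : Measure Ω) (Z : ℕ → Ω → (E → 𝔾 N))
    (hZ : ∀ k, Measurable (Z k)) (m : Measure (E → 𝔾 N)) (hmarg : ∀ k, P.map (Z k) = m)
    (hstep : ∀ k, ∀ᵐ ω ∂P, dist (Z k ω) (Z (k + 1) ω) ≤ ρ) (n : ℕ) :
    P {ω | connectedComponentIn Dᶜ (Z n ω) ≠ connectedComponentIn Dᶜ (Z 0 ω)} ≤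
      n * (2 * m (cthickening (2 * ρ) D)) :=
  measure_sector_ne_le_nsteps_cthickening
    (fun a b hab => exists_localPaths_config hρ0 hρ a b hab) P Z hZ m hmarg hstep n

end Summit.Ventures.LatticeQCDFlow.Theory2.Lattice.UN
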